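import Summits.QuantumFields.YangMills.Theorems.BalabanUVNodesN15KingModelPotentialDressedStepGrad

/-!
# N15 (NE2⁺), King-model rung, part 19a: King's Prop. 3.8 (3.71) LINE 2 for the DRESSED minimiser ALONG THE RUN

Cell `pub-ymgap-dag-n15-d` (R134 acceleration DAG, node N15 = NE2, strategy s3 KING-MODEL RUNG), part 19a.  Part 18d proved the two-run
GRADIENT step inequality `kingHPot_grad_step` for the dressed minimiser `ℋ_{k,w}` (part 10b `kingHPot`) with NUMERICAL letters, and the
undressed line 2 `dkingH_step_kingU`.  This file is the run corollary the part-18d docstring announced: every letter is a tree theorem,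
so along King's run on the King-admissible tori, for every coherent potential tower `v` in the window,

  ★★ `dkingHPot_step_kingU` — `∃ w̄, c, δ > 0` such that for every volume exponent `e`, every tower `v` of size `≤ w₀ ≤ w̄` with one-step
  coherence `(ν₀, s ≤ L^{−1∕2})`, every `k ≥ 1`, unit site `b`, direction `μ` and fine point `x′` of the finer run (`x` under `x′`):
  `|N′·(ℋ_{k+1,v}(x′+e_μ, b) − ℋ_{k+1,v}(x′, b)) − N·(ℋ_{k,v}(x+e_μ, b) − ℋ_{k,v}(x, b))| ≤ c·((L^{−γ∕2})^k + ν₀s^k)·e^{−δ|B(x′) − b|}`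
  for every `0 ≤ γ < 1` — constants uniform in `k`, the volume and the potential.

Assembly (exactly as part 14 assembled line 1): 18d §1 fed by 18d §2 (`D₀ = C_D(L^{−γ∕2})^k`), 18a `fullPropD_riemannMassW_unif` (`C_W`),
18c `fullPropD_riemannRateW_unif` (`R_W = C_R(L^{−γ∕2})^k`, `n = 1`, weights moved to the finer lattice by `blockOf_underPtN`), 11d
`kingHPot_decay_kingU` (`H′`), 14 `kingHPot_stepDecay_kingU` (`S = c_S((L^{−1∕2})^k + ν₀s^k)`), all read at the common decay rate
`δ = min(…)` (`decay_mono`) inside the common window `w̄ = min(w̄_{9c}, w̄_{11d}, w̄_{14})`; bookkeeping `L^{−1∕2} ≤ L^{−γ∕2}` (`γ ≤ 1`).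

HONEST SCOPE.  King's A = 0 scalar model on the King-admissible tori `Π ℤ∕(2L^{e+1})`, odd `L ≥ 3`, `a, m² > 0`; scalar potentials (NOT gauge
fields; nothing here is Bałaban's `H_k(U)` of [B9] §D); count-neutral (`--supports`), not a discharge of N15, nothing in `YMDAG.*` touched;
THEOREMS ONLY (0 `def`, 0 `sorry`), standard axioms.

References: C. King, Commun. Math. Phys. 102 (1986) 649–677: (2.13)–(2.15) p.653, Theorem 3.3 p.655 ((3.7) p.656), Prop. 3.8 (3.71) p.664
(second line) and p.664 (pairing `x′ ∈ B^n(x)`) (bib key `King1986`); [B9] = Bałaban, Commun. Math. Phys. 102 (1985) 385–462, §D (3.133) p.422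
(template only).
-/

noncomputable section
open scoped BigOperators Matrix
open Finset

namespace Summit.QuantumFields.YangMills.BalabanUVNodes.N15.KingModel

open Literature.MathematicalPhysics.QuantumFieldTheory.Balaban1983to89 hiding blockOf
open Literature.MathematicalPhysics.QuantumFieldTheory.Balaban1983to89.B5Prop11Plancherel (Tor fine unitVec)
open Literature.MathematicalPhysics.QuantumFieldTheory.King1986 (aK aK_pos)
open Literature.MathematicalPhysics.QuantumFieldTheory.King1986.Torus
open Summit.QuantumFields.YangMills.BalabanUVNodes.N15KingModelRung (kingH)
open Summit.QuantumFields.YangMills.BalabanUVNodes.N15KingModelRung.Curved (underPtN val_underPtN blockOf_underPtN)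

variable {d : ℕ}

section GradStepRun

open Real

variable (L : ℕ) [NeZero L]

/-- **KING'S PROP. 3.8 (3.71) LINE 2 FOR THE DRESSED MINIMISER ALONG THE RUN** (module docstring; `0 ≤ γ < 1`): there are `w̄, c, δ > 0` such
that for every volume exponent `e`, every potential tower `v` of size `≤ w₀ ≤ w̄` with one-step coherence defect `≤ ν₀s^k` (`0 ≤ s ≤ L^{−1∕2}`),
every `k ≥ 1`, unit site `b`, direction `μ` and fine point `x′` of the finer run (`x` under `x′`),
`|N′·(ℋ_{k+1,v}(x′+e_μ, b) − ℋ_{k+1,v}(x′, b)) − N·(ℋ_{k,v}(x+e_μ, b) − ℋ_{k,v}(x, b))| ≤ c·((L^{−γ∕2})^k + ν₀s^k)·e^{−δ|B(x′) − b|}`.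
[cite: King1986, (2.13)–(2.15) p.653, Prop. 3.8 (3.71) p.664 (second line) and p.664 (pairing)] -/
theorem dkingHPot_step_kingU (hLodd : Odd L) (hL : 2 ≤ L) {a m2 : ℝ} (ha : 0 < a) (hm : 0 < m2) {γ : ℝ} (hγ0 : 0 ≤ γ)
    (hγ1 : γ < 1) :
    ∃ wb c δ : ℝ, 0 < wb ∧ 0 < c ∧ 0 < δ ∧ ∀ (e : ℕ) (v : ∀ N : ℕ, Tor (fine N (kingU d L e)) → ℝ) (w₀ ν₀ s : ℝ),
      (∀ (N : ℕ) (x : Tor (fine N (kingU d L e))), |v N x| ≤ w₀) → w₀ ≤ wb → 0 ≤ ν₀ → 0 ≤ s → s ≤ (L : ℝ) ^ (-(1 / 2 : ℝ)) →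
      (∀ (k : ℕ), 1 ≤ k → ∀ x' : Tor (fine (L ^ 1 * L ^ k) (kingU d L e)),
          |v (L ^ 1 * L ^ k) x' - v (L ^ k) (underPtN L k 1 (kingU d L e) x')| ≤ ν₀ * s ^ k) →
      ∀ (k : ℕ), 1 ≤ k → ∀ (b : Tor (kingU d L e)) (μ : Fin (d + 1)) (x' : Tor (fine (L ^ 1 * L ^ k) (kingU d L e))),
        |((L ^ 1 * L ^ k : ℕ) : ℝ) *
              (kingHPot L (L ^ 1 * L ^ k) (kingU d L e) a m2 (k + 1) (v (L ^ 1 * L ^ k)) b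
                  (x' + unitVec (fine (L ^ 1 * L ^ k) (kingU d L e)) μ)
                - kingHPot L (L ^ 1 * L ^ k) (kingU d L e) a m2 (k + 1) (v (L ^ 1 * L ^ k)) b x')
            - ((L ^ k : ℕ) : ℝ) *
              (kingHPot L (L ^ k) (kingU d L e) a m2 k (v (L ^ k)) b
                  (underPtN L k 1 (kingU d L e) x' + unitVec (fine (L ^ k) (kingU d L e)) μ)
                - kingHPot L (L ^ k) (kingU d L e) a m2 k (v (L ^ k)) b (underPtN L k 1 (kingU d L e) x'))|
          ≤ c * (((L : ℝ) ^ (-(γ / 2))) ^ k + ν₀ * s ^ k)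
            * Real.exp (-(δ * tdistT (kingU d L e) (blockOf (L ^ 1 * L ^ k) (kingU d L e) x') b)) := by
  have hL1 : 1 < L := by omega
  have hLr : (1 : ℝ) < L := by exact_mod_cast hL1
  -- the letters: undressed gradient step (18d §2), weighted gradient Riemann mass ∕ rate (18a ∕ 18c), dressed decay (11d), dressed value step (14)
  obtain ⟨δD, CD, hδD, hCD, HD⟩ := dkingH_step_kingU (d := d) L hLodd hL ha hm hγ0 hγ1
  obtain ⟨δA, CA, hδA, hCA, HA⟩ := fullPropD_riemannMassW_unif (d := d) L hLodd hL ha hm.le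
  obtain ⟨δB, CB, hδB, hCB, HB⟩ := fullPropD_riemannRateW_unif (d := d) L hLodd hL ha hm.le hγ0 hγ1
  obtain ⟨wH, cH, δH, hwH, hcH, hδH, HH⟩ := kingHPot_decay_kingU (d := d) L hLodd hL ha hm
  obtain ⟨wS, cS, δS, hwS, hcS, hδS, HS⟩ := kingHPot_stepDecay_kingU (d := d) L hLodd hL ha hm
  obtain ⟨-, -, hwbar⟩ := dressedConsts_nonneg (d := d) ha hL
  set δ : ℝ := min (min δD δH) (min (min δA δB) δS) with hδdef
  have hδ : 0 < δ := lt_min (lt_min hδD hδH) (lt_min (lt_min hδA hδB) hδS)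
  have hδD' : δ ≤ δD := (min_le_left _ _).trans (min_le_left _ _)
  have hδH' : δ ≤ δH := (min_le_left _ _).trans (min_le_right _ _)
  have hδA' : δ ≤ δA := (min_le_right _ _).trans ((min_le_left _ _).trans (min_le_left _ _))
  have hδB' : δ ≤ δB := (min_le_right _ _).trans ((min_le_left _ _).trans (min_le_right _ _))
  have hδS' : δ ≤ δS := (min_le_right _ _).trans (min_le_right _ _)
  set wb : ℝ := min (wbarK (d + 1) a L) (min wH wS) with hwbdef
  have hwb : 0 < wb := lt_min hwbar (lt_min hwH hwS)
  set c : ℝ := CD + CB * wb * cH + CA * cH + 2 * (CA * wb * cS) + 1 with hcdef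
  have hc : 0 < c := by positivity
  refine ⟨wb, c, δ, hwb, hc, hδ, fun e v w₀ ν₀ s hv hw hν₀ hs0 hs1 hcoh k hk1 b μ x' => ?_⟩
  set θ : ℝ := (L : ℝ) ^ (-(γ / 2)) with hθdef
  have hθ0 : 0 ≤ θ := Real.rpow_nonneg (Nat.cast_nonneg _) _
  set r : ℝ := (L : ℝ) ^ (-(1 / 2 : ℝ)) with hrdef
  have hr0 : 0 ≤ r := Real.rpow_nonneg (Nat.cast_nonneg _) _
  have hrθ : r ≤ θ := Real.rpow_le_rpow_of_exponent_le hLr.le (by linarith)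
  have hw₀ : 0 ≤ w₀ := (abs_nonneg _).trans (hv 0 fun _ => 0)
  have hM' : ∀ μ, kingU d L e μ = 2 * L ^ (e + 1) := fun μ => by
    show L * (2 * L ^ e) = 2 * L ^ (e + 1)
    ring
  have hN' : L ^ 1 * L ^ k = L ^ (k + 1) := by ring
  have hak : 0 < aK a L k := aK_pos ha hLr hk1
  have hak' : 0 < aK a L (k + 1) := aK_pos ha hLr (by omega)
  -- the window: the gap of 9c for both runs' dressed operators, and the windows of 11d ∕ 14
  have hwbar' : w₀ ≤ wbarK (d + 1) a L := hw.trans (min_le_left _ _)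
  have hwH' : w₀ ≤ wH := hw.trans ((min_le_right _ _).trans (min_le_left _ _))
  have hwS' : w₀ ≤ wS := hw.trans ((min_le_right _ _).trans (min_le_right _ _))
  have hlo : ∀ (N : ℕ) (x : Tor (fine N (kingU d L e))), -w₀ ≤ v N x := fun N x => (abs_le.mp (hv N x)).1
  have hB : IsUnit (fineOpPot (L ^ k) (kingU d L e) (aK a L k) (((L ^ k : ℕ) : ℝ) ^ 2) m2 (v (L ^ k))) :=
    fineOpPot_isUnit hak.le hm.le (hlo (L ^ k)) (by
      obtain ⟨-, -, hgap, -⟩ := gap_unif (d := d) ha hL hk1 hwbar'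
      have hP : 0 ≤ (2 * ((d + 1 : ℕ) : ℝ) + aK a L k) * (4 * kapCT (d + 1) a L) ^ 2 := by positivity
      linarith)
  have hB' : IsUnit (fineOpPot (L ^ 1 * L ^ k) (kingU d L e) (aK a L (k + 1)) (((L ^ 1 * L ^ k : ℕ) : ℝ) ^ 2) m2
      (v (L ^ 1 * L ^ k))) :=
    fineOpPot_isUnit hak'.le hm.le (hlo (L ^ 1 * L ^ k)) (by
      obtain ⟨-, -, hgap, -⟩ := gap_unif (d := d) ha hL (by omega : 1 ≤ k + 1) hwbar'
      have hP : 0 ≤ (2 * ((d + 1 : ℕ) : ℝ) + aK a L (k + 1)) * (4 * kapCT (d + 1) a L) ^ 2 := by positivity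
      linarith)
  -- the letters read at the common rate `δ`
  have hstep0 : ∀ x' : Tor (fine (L ^ 1 * L ^ k) (kingU d L e)),
      |((L ^ 1 * L ^ k : ℕ) : ℝ) * (kingH L (L ^ 1 * L ^ k) (kingU d L e) a m2 (k + 1) b (x' + unitVec (fine (L ^ 1 * L ^ k) (kingU d L e)) μ)
            - kingH L (L ^ 1 * L ^ k) (kingU d L e) a m2 (k + 1) b x')
        - ((L ^ k : ℕ) : ℝ) * (kingH L (L ^ k) (kingU d L e) a m2 k b (underPtN L k 1 (kingU d L e) x' + unitVec (fine (L ^ k) (kingU d L e)) μ)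
            - kingH L (L ^ k) (kingU d L e) a m2 k b (underPtN L k 1 (kingU d L e) x'))|
        ≤ CD * θ ^ k * Real.exp (-(δ * tdistT (kingU d L e) (blockOf (L ^ 1 * L ^ k) (kingU d L e) x') b)) :=
    fun x' => decay_mono (by positivity) hδD' ((tdistT_isPseudoDist (kingU d L e)).nonneg _ _) (HD e k hk1 b μ x')
  have hmassDW : ∀ x : Tor (fine (L ^ k) (kingU d L e)), (((L ^ k : ℕ) : ℝ) ^ (d + 1))⁻¹ *
      ∑ u, |((L ^ k : ℕ) : ℝ) * (constrainedProp (L ^ k) (kingU d L e) (aK a L k) (((L ^ k : ℕ) : ℝ) ^ 2) m2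
            (x + unitVec (fine (L ^ k) (kingU d L e)) μ) u
          - constrainedProp (L ^ k) (kingU d L e) (aK a L k) (((L ^ k : ℕ) : ℝ) ^ 2) m2 x u)|
        * Real.exp (δ * tdistT (kingU d L e) (blockOf (L ^ k) (kingU d L e) x) (blockOf (L ^ k) (kingU d L e) u)) ≤ CA :=
    fun x => HA k hk1 δ hδ.le hδA' (L ^ k) rfl (e + 1) (kingU d L e) hM' m2 hm le_rfl μ x
  have hrateDW : ∀ x' : Tor (fine (L ^ 1 * L ^ k) (kingU d L e)), (((L ^ 1 * L ^ k : ℕ) : ℝ) ^ (d + 1))⁻¹ *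
      ∑ u', |((L ^ 1 * L ^ k : ℕ) : ℝ) *
            (constrainedProp (L ^ 1 * L ^ k) (kingU d L e) (aK a L (k + 1)) (((L ^ 1 * L ^ k : ℕ) : ℝ) ^ 2) m2
                (x' + unitVec (fine (L ^ 1 * L ^ k) (kingU d L e)) μ) u'
              - constrainedProp (L ^ 1 * L ^ k) (kingU d L e) (aK a L (k + 1)) (((L ^ 1 * L ^ k : ℕ) : ℝ) ^ 2) m2 x' u')
          - ((L ^ k : ℕ) : ℝ) *
            (constrainedProp (L ^ k) (kingU d L e) (aK a L k) (((L ^ k : ℕ) : ℝ) ^ 2) m2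
                (underPtN L k 1 (kingU d L e) x' + unitVec (fine (L ^ k) (kingU d L e)) μ) (underPtN L k 1 (kingU d L e) u')
              - constrainedProp (L ^ k) (kingU d L e) (aK a L k) (((L ^ k : ℕ) : ℝ) ^ 2) m2 (underPtN L k 1 (kingU d L e) x')
                (underPtN L k 1 (kingU d L e) u'))|
        * Real.exp (δ * tdistT (kingU d L e) (blockOf (L ^ 1 * L ^ k) (kingU d L e) x') (blockOf (L ^ 1 * L ^ k) (kingU d L e) u'))
        ≤ CB * θ ^ k := fun x' => by
    have h := HB k hk1 δ hδ.le hδB' 1 le_rfl (e + 1) (kingU d L e) hM' m2 hm le_rfl μ x'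
    simpa only [blockOf_underPtN] using h
  have hwk : ∀ y, |v (L ^ k) y| ≤ w₀ := hv (L ^ k)
  have hwk' : ∀ y', |v (L ^ 1 * L ^ k) y'| ≤ w₀ := hv (L ^ 1 * L ^ k)
  have hH' : ∀ u' : Tor (fine (L ^ 1 * L ^ k) (kingU d L e)),
      |kingHPot L (L ^ 1 * L ^ k) (kingU d L e) a m2 (k + 1) (v (L ^ 1 * L ^ k)) b u'|
        ≤ cH * Real.exp (-(δ * tdistT (kingU d L e) (blockOf (L ^ 1 * L ^ k) (kingU d L e) u') b)) :=
    fun u' => decay_mono hcH.le hδH' ((tdistT_isPseudoDist (kingU d L e)).nonneg _ _)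
      (HH e (k + 1) (by omega) (L ^ 1 * L ^ k) hN' (v (L ^ 1 * L ^ k)) w₀ hwk' hwH' b u')
  have hS : ∀ u' : Tor (fine (L ^ 1 * L ^ k) (kingU d L e)),
      |kingHPot L (L ^ 1 * L ^ k) (kingU d L e) a m2 (k + 1) (v (L ^ 1 * L ^ k)) b u'
          - kingHPot L (L ^ k) (kingU d L e) a m2 k (v (L ^ k)) b (underPtN L k 1 (kingU d L e) u')|
        ≤ cS * (r ^ k + ν₀ * s ^ k) * Real.exp (-(δ * tdistT (kingU d L e) (blockOf (L ^ 1 * L ^ k) (kingU d L e) u') b)) :=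
    fun u' => decay_mono (by positivity) hδS' ((tdistT_isPseudoDist (kingU d L e)).nonneg _ _)
      (HS e v w₀ ν₀ s hv hwS' hν₀ hs0 hs1 hcoh k hk1 b u')
  have h := kingHPot_grad_step L hak.le hak'.le hm hB hB' b μ hcH.le (by positivity : 0 ≤ cS * (r ^ k + ν₀ * s ^ k)) hδ.le
    hstep0 hmassDW hrateDW hwk hwk' (hcoh k hk1) hH' hS x'
  refine h.trans (mul_le_mul_of_nonneg_right ?_ (Real.exp_pos _).le)
  -- bookkeeping: `C_Dθ^k + C_Rθ^k·w₀c_H + C_W(ν₀s^k·c_H + w₀·c_S(r^k + ν₀s^k)) ≤ c·(θ^k + ν₀s^k)` with `w₀ ≤ w̄`, `r ≤ θ`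
  have hθk : 0 ≤ θ ^ k := pow_nonneg hθ0 k
  have hνs : 0 ≤ ν₀ * s ^ k := by positivity
  have hrk : r ^ k ≤ θ ^ k := pow_le_pow_left₀ hr0 hrθ k
  have t1 := mul_le_mul_of_nonneg_left hw (by positivity : 0 ≤ CB * cH * θ ^ k)
  have t2 := mul_le_mul_of_nonneg_left (mul_le_mul hrk hw hw₀ hθk) (by positivity : 0 ≤ CA * cS)
  have t3 := mul_le_mul_of_nonneg_left hw (by positivity : 0 ≤ CA * cS * (ν₀ * s ^ k))
  have n1 : 0 ≤ CA * cH * θ ^ k := by positivity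
  have n2 : 0 ≤ CA * wb * cS * θ ^ k := by positivity
  have n3 : 0 ≤ CD * (ν₀ * s ^ k) := by positivity
  have n4 : 0 ≤ CB * wb * cH * (ν₀ * s ^ k) := by positivity
  have n5 : 0 ≤ CA * wb * cS * (ν₀ * s ^ k) := by positivity
  rw [hcdef]
  linarith

end GradStepRun

end Summit.QuantumFields.YangMills.BalabanUVNodes.N15.KingModel

end
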